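import Literature.Computability.Complexity.ThreeDMGadget
import Literature.Computability.Complexity.KSATReductions
import Literature.Computability.Complexity.IndexAllBricks
import Literature.Computability.Complexity.ListBricks
import HarnessLib

/-!
# ONE-IN-THREE 3SAT `≤ₚ` 3-DIMENSIONAL MATCHING: the machine half

Support file for the discharge of `Literature.Computability.Complexity.isNPComplete_THREEDM`
(`KarpProblems.lean`; Karp 1972, Main Theorem, problem 17; Garey–Johnson 1979, Thm. 3.2).
`ThreeDMGadget.lean` attaches to a clause list `φ` the instance `ThreeDM.inst φ = ⟨q, U⟩`
(`q = 6m`, the occurrence-indexed Garey–Johnson ring gadget) and proves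
`φ.XSatisfiable ↔ inst φ ∈ threeDMSet` for clause lists with three literals per clause. This file
computes the code of `inst φ` from the code of `φ` in polynomial time and assembles the Karp reduction:

* **`ThreeDM.ONEIN3SAT_karpReducible_THREEDM : ONEIN3SAT ≤ₚ THREEDM`**, by the map `ThreeDM.outF ∈ FP`;
* `ThreeDM.THREEDM_isNPHard_of : IsNPHard ONEIN3SAT → IsNPHard THREEDM` (the assembly with
  `Schaefer1978_oneInThreeSAT_NPHard_holds` and `THREEDM ∈ NP` is in `KarpProblemsProofs.lean`).

## The machine (brick algebra only; no machine is written)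

`outF = iteFn guardF goodF (code of ⟨1, ∅⟩)`. The guard (`guardF_eq_true_iff`) tests that the input
`w` is the canonical code of a clause list (`KSATRed.isCanonFn`) whose every clause item has the header
`1³` and three pairwise distinct literal items (`threeLitFn`, an `allFn` over the clause items) — exactly
the instances of `ONEIN3SAT` (`IsThreeLiteralClauses`, `Nodup` included: `[[x, x, y]]` is one-in-three
satisfiable and its `⟨q, U⟩` is a YES instance, yet its code is not in `ONEIN3SAT`); everything else is
sent to the NO instance `⟨1, ∅⟩`. On a genuine code, `goodF w = ⟨bin q, bits⟩` where
`bits = tabF w` is the concatenation fold (`Brick.foldLoop appF`, `216 |w|³ ≥ q³` rounds) of the one-bit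
function `bitFn ⟨w, 1ᵏ⟩ = [P φ (k / q²) ((k mod q²) / q) (k mod q)]` (`tabF_encode`; this is the
characteristic vector of `U` in the order of `finTripleEquiv`, `ThreeDM.encode_inst`). The bit function
decodes `k` by two unary divisions (`Plumb.divModFn`) into the record `⟨w, ⟨1ᵃ, ⟨1ᵇ, 1ᶜ⟩⟩⟩` and runs the
triple test `pmF` = the machine form `ThreeDM.PM` of the triple predicate (`pmF_eq_true_iff`,
`PM_iff_P`): unary comparisons (`ltLenF`, `eqPairFn`), the literal of an occurrence read off the code
by `nthItemFn` twice (`litF`/`varF`/`polF`, values `fstF_litItem`, `headD_sndF_litItem`), the cyclic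
offsets `off`/`offP` by `Plumb.modLenFn` (`offF`, `offPF`), the search-free successor test `IsNext` as an
`allIdxFn` over the occurrences (`isNextF_eq_true_iff`), and the selector tips through `xorFn`
(`selPF_eq_true_iff`).

## References

* [GareyJohnson1979] M. R. Garey, D. S. Johnson, *Computers and Intractability*, Freeman 1979,
  §3.1.2, Thm. 3.2 (3DM is NP-complete; "it is easy to see that M can be constructed in polynomial
  time"), book pp. 50–53 (held, PDF pp. 54–56); A9.1 [LO4] ONE-IN-THREE 3SAT, p. 259.
* [Karp1972] R. M. Karp, *Reducibility among combinatorial problems*, 1972, §3–§4, Main Theorem,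
  problem 17 (3-DIMENSIONAL MATCHING).
* [AroraBarakCC2009] S. Arora, B. Barak, *Computational Complexity*, CUP 2009, §1.3 (polynomial time is
  closed under composition and bounded loops), §0.1 (codes of lists), Def. 2.7 (Karp reductions).
-/

noncomputable section

namespace Literature.Computability.Complexity

namespace ThreeDM

open _root_.Computability Polynomial Brick HashBricks Plumb KSATRed NegCNF
open scoped Notation

/-! ### The shape of CNF codes -/

/-- The code of a literal. [cite: AroraBarak2009, §0.1] -/
theorem encode_lit (l : Literal ℕ) : encodingLiteral.encode l = boolPair (encodeNat l.1) [l.2] := rfl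

/-- The code of a clause. [cite: AroraBarak2009, §0.1] -/
theorem encode_clause (c : Clause ℕ) :
    encodingClause.encode c = boolPair (ones c.length) (encList (c.map encodingLiteral.encode)) := by
  rw [show encodingClause = encodingLiteral.listBool from rfl, listBool_encode_eq_encList,
    OracleCompose.unaryEncodeNat_eq_replicate]

/-- The code of a CNF. [cite: AroraBarak2009, §0.1] -/
theorem encode_cnf (φ : CNF ℕ) :
    encodingCNF.encode φ = boolPair (ones φ.length) (encList (φ.map encodingClause.encode)) := by
  rw [show encodingCNF = encodingClause.listBool from rfl, listBool_encode_eq_encList,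
    OracleCompose.unaryEncodeNat_eq_replicate]

/-- Items of a coded list by unary index. [folklore] -/
theorem nthItemFn_ones_encList (j : ℕ) (L : List (List Bool)) :
    nthItemFn (boolPair (ones j) (encList L)) = L.getD j [] := by
  rw [nthItemFn_boolPair, List.length_replicate, sndF_iterate_encList, fstF_encList, List.getD_eq_getElem?_getD,
    ← List.head?_drop]
  cases L.drop j <;> rfl

/-- Items of the empty string. [folklore] -/
theorem nthItemFn_ones_nil (j : ℕ) : nthItemFn (boolPair (ones j) []) = [] := by
  rw [nthItemFn_boolPair, sndF_iterate_nil, Brick.fstF_nil]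

variable {φ : CNF ℕ}

/-- The clause item `j` of the code of `φ`. [folklore] -/
theorem clauseItem_eq (φ : CNF ℕ) (j : ℕ) :
    nthItemFn (boolPair (ones j) (sndF (encodingCNF.encode φ))) = (φ.map encodingClause.encode).getD j [] := by
  rw [encode_cnf, sndF_boolPair, nthItemFn_ones_encList]

/-- **The literal item of an occurrence**: literal `o % 3` of clause `o / 3`, read off the code. For a
clause list with three literals per clause this is the code of `lit φ o` inside the instance and `ε`
outside. [folklore] -/
def litItem (φ : CNF ℕ) (o : ℕ) : List Bool :=
  nthItemFn (boolPair (ones (o % 3)) (sndF (nthItemFn (boolPair (ones (o / 3)) (sndF (encodingCNF.encode φ))))))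

/-- The literal item inside the instance. [folklore] -/
theorem litItem_of_lt (h3 : ∀ c ∈ φ, c.length = 3) {o : ℕ} (ho : o < M φ) :
    litItem φ o = encodingLiteral.encode (lit φ o) := by
  have hM := M_eq φ
  have hj : o / 3 < φ.length := by omega
  have hl : (φ[o / 3]).length = 3 := h3 _ (List.getElem_mem hj)
  rw [litItem, clauseItem_eq, List.getD_eq_getElem _ _ (by simpa using hj), List.getElem_map, encode_clause,
    sndF_boolPair, nthItemFn_ones_encList, List.getD_eq_getElem _ _ (by simp [hl]; omega), List.getElem_map]
  congr 1
  have := lit_eq_getElem h3 hj (p := o % 3) (by omega)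
  rw [show 3 * (o / 3) + o % 3 = o by omega] at this
  exact this.symm

/-- The literal item outside the instance. [folklore] -/
theorem litItem_of_le {o : ℕ} (ho : M φ ≤ o) : litItem φ o = [] := by
  have hM := M_eq φ
  have hj : φ.length ≤ o / 3 := by omega
  rw [litItem, clauseItem_eq, List.getD_eq_default _ _ (by simpa using hj), HashBricks.sndF_nil, nthItemFn_ones_nil]

/-- The literal outside the instance is the default. [folklore] -/
theorem lit_of_le {o : ℕ} (ho : M φ ≤ o) : lit φ o = (0, false) := by
  have hM := M_eq φ
  have hj : φ.length ≤ o / 3 := by omega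
  rw [lit, List.getD_eq_default φ [] hj]
  rfl

/-- **The variable numeral of an occurrence, read off the code.** [folklore] -/
theorem fstF_litItem (h3 : ∀ c ∈ φ, c.length = 3) (o : ℕ) : fstF (litItem φ o) = encodeNat (var φ o) := by
  rcases Nat.lt_or_ge o (M φ) with ho | ho
  · rw [litItem_of_lt h3 ho, encode_lit, fstF_boolPair]; rfl
  · rw [litItem_of_le ho, Brick.fstF_nil, var, lit_of_le ho]; rfl

/-- **The polarity of an occurrence, read off the code.** [folklore] -/
theorem headD_sndF_litItem (h3 : ∀ c ∈ φ, c.length = 3) (o : ℕ) : (sndF (litItem φ o)).headD false = pol φ o := by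
  rcases Nat.lt_or_ge o (M φ) with ho | ho
  · rw [litItem_of_lt h3 ho, encode_lit, sndF_boolPair]; rfl
  · rw [litItem_of_le ho, Brick.sndF_nil, pol, lit_of_le ho]; rfl

/-! ### Lookup bricks: the literal item at a unary occurrence index -/

/-- From extractors `gW` (the code) and `gO` (a unary index `1ᵒ`): `⟨1^{o/3}, 1^{o%3}⟩`. [folklore] -/
def dm3 (gO : List Bool → List Bool) : List Bool → List Bool := divModFn ∘ fanoutFn (fun _ => ones 3) gO

/-- The literal item brick. [folklore] -/
def litF (gW gO : List Bool → List Bool) : List Bool → List Bool :=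
  nthItemFn ∘ fanoutFn (sndF ∘ dm3 gO) (sndF ∘ nthItemFn ∘ fanoutFn (fstF ∘ dm3 gO) (sndF ∘ gW))

/-- The variable-numeral brick. [folklore] -/
def varF (gW gO : List Bool → List Bool) : List Bool → List Bool := fstF ∘ litF gW gO

/-- The polarity brick (one bit). [folklore] -/
def polF (gW gO : List Bool → List Bool) : List Bool → List Bool := headBitFn ∘ sndF ∘ litF gW gO

/-- `litF ∈ FP`. [folklore] -/
theorem litF_mem_FP {gW gO : List Bool → List Bool} (hW : gW ∈ FP) (hO : gO ∈ FP) : litF gW gO ∈ FP := by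
  have hdm : dm3 gO ∈ FP := comp_mem_FP divModFn_mem_FP (fanoutFn_mem_FP (const_mem_FP _) hO)
  exact comp_mem_FP nthItemFn_mem_FP (fanoutFn_mem_FP (comp_mem_FP sndF_mem_FP hdm)
    (comp_mem_FP sndF_mem_FP (comp_mem_FP nthItemFn_mem_FP (fanoutFn_mem_FP (comp_mem_FP fstF_mem_FP hdm)
      (comp_mem_FP sndF_mem_FP hW)))))

/-- `varF ∈ FP`. [folklore] -/
theorem varF_mem_FP {gW gO : List Bool → List Bool} (hW : gW ∈ FP) (hO : gO ∈ FP) : varF gW gO ∈ FP :=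
  comp_mem_FP fstF_mem_FP (litF_mem_FP hW hO)

/-- `polF ∈ FP`. [folklore] -/
theorem polF_mem_FP {gW gO : List Bool → List Bool} (hW : gW ∈ FP) (hO : gO ∈ FP) : polF gW gO ∈ FP :=
  comp_mem_FP headBitFn_mem_FP (comp_mem_FP sndF_mem_FP (litF_mem_FP hW hO))

/-- `polF` is one-bit. [folklore] -/
theorem oneBit_polF (gW gO : List Bool → List Bool) : OneBit (polF gW gO) := oneBit_headBitFn.comp _

/-- Value of `litF`. [folklore] -/
theorem litF_apply {gW gO : List Bool → List Bool} {r : List Bool} {o : ℕ} (hW : gW r = encodingCNF.encode φ)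
    (hO : gO r = ones o) : litF gW gO r = litItem φ o := by
  simp [litF, dm3, hW, hO, litItem]

/-- **Value of `varF`.** [folklore] -/
theorem varF_apply (h3 : ∀ c ∈ φ, c.length = 3) {gW gO : List Bool → List Bool} {r : List Bool} {o : ℕ}
    (hW : gW r = encodingCNF.encode φ) (hO : gO r = ones o) : varF gW gO r = encodeNat (var φ o) := by
  rw [varF, Function.comp_apply, litF_apply hW hO, fstF_litItem h3]

/-- **Value of `polF`.** [folklore] -/
theorem polF_apply (h3 : ∀ c ∈ φ, c.length = 3) {gW gO : List Bool → List Bool} {r : List Bool} {o : ℕ}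
    (hW : gW r = encodingCNF.encode φ) (hO : gO r = ones o) : polF gW gO r = [pol φ o] := by
  rw [polF, Function.comp_apply, Function.comp_apply, litF_apply hW hO, headBitFn_apply, headD_sndF_litItem h3]

/-! ### The guard: codes of clause lists with three pairwise distinct literals per clause -/

/-- On `⟨x, a⟩` (`a` a clause item): literal item `p`. [folklore] -/
def gLit (p : ℕ) : List Bool → List Bool := nthItemFn ∘ fanoutFn (fun _ => ones p) (sndF ∘ sndF)

/-- On `⟨x, a⟩`: the clause item `a` has header `1³` and three pairwise distinct literal items.
[cite: GareyJohnson1979, LO4 (p. 259)] -/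
def clause3Fn : List Bool → List Bool :=
  andFn (eqPairFn ∘ fanoutFn (onesFn ∘ fstF ∘ sndF) (fun _ => ones 3))
    (andFn (notFn (eqPairFn ∘ fanoutFn (gLit 0) (gLit 1)))
      (andFn (notFn (eqPairFn ∘ fanoutFn (gLit 0) (gLit 2))) (notFn (eqPairFn ∘ fanoutFn (gLit 1) (gLit 2)))))

/-- `clause3Fn ∈ FP`. [folklore] -/
theorem clause3Fn_mem_FP : clause3Fn ∈ FP := by
  have hg : ∀ p, gLit p ∈ FP := fun p =>
    comp_mem_FP nthItemFn_mem_FP (fanoutFn_mem_FP (const_mem_FP _) (comp_mem_FP sndF_mem_FP sndF_mem_FP))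
  have hne : ∀ p p', notFn (eqPairFn ∘ fanoutFn (gLit p) (gLit p')) ∈ FP := fun p p' =>
    notFn_mem_FP (comp_mem_FP eqPairFn_mem_FP (fanoutFn_mem_FP (hg p) (hg p')))
  exact andFn_mem_FP (comp_mem_FP eqPairFn_mem_FP (fanoutFn_mem_FP
    (comp_mem_FP onesFn_mem_FP (comp_mem_FP fstF_mem_FP sndF_mem_FP)) (const_mem_FP _)))
    (andFn_mem_FP (hne 0 1) (andFn_mem_FP (hne 0 2) (hne 1 2)))

/-- `clause3Fn` is one-bit. [folklore] -/
theorem oneBit_clause3Fn : OneBit clause3Fn :=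
  oneBit_andFn (oneBit_eqPairFn.comp _) (oneBit_andFn (oneBit_notFn (oneBit_eqPairFn.comp _))
    (oneBit_andFn (oneBit_notFn (oneBit_eqPairFn.comp _)) (oneBit_notFn (oneBit_eqPairFn.comp _))))

/-- `onesFn` as `ones`. [folklore] -/
theorem onesFn_eq_ones' (w : List Bool) : onesFn w = ones w.length := by
  rw [onesFn, OracleCompose.unaryEncodeNat_eq_replicate]

/-- `ones` is injective. [folklore] -/
theorem ones_inj' {m n : ℕ} : ones m = ones n ↔ m = n :=
  ⟨fun h => by simpa using congrArg List.length h, fun h => h ▸ rfl⟩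

/-- **Value of `clause3Fn` on a clause code.** [cite: GareyJohnson1979, LO4 (p. 259)] -/
theorem clause3Fn_boolPair_encode (x : List Bool) (c : Clause ℕ) :
    clause3Fn (boolPair x (encodingClause.encode c)) = [decide (c.length = 3 ∧ c.Nodup)] := by
  have hg : ∀ p, gLit p (boolPair x (encodingClause.encode c)) = (c.map encodingLiteral.encode).getD p [] := by
    intro p; simp [gLit, encode_clause, nthItemFn_ones_encList]
  have h0 : (eqPairFn ∘ fanoutFn (onesFn ∘ fstF ∘ sndF) (fun _ => ones 3)) (boolPair x (encodingClause.encode c)) =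
      [decide (c.length = 3)] := by
    simp [encode_clause, onesFn_eq_ones', eqPairFn_boolPair]
  have hne : ∀ p p', notFn (eqPairFn ∘ fanoutFn (gLit p) (gLit p')) (boolPair x (encodingClause.encode c)) =
      [!decide ((c.map encodingLiteral.encode).getD p [] = (c.map encodingLiteral.encode).getD p' [])] := by
    intro p p'
    rw [notFn_apply]
    simp only [Function.comp_apply, fanoutFn_apply, hg, eqPairFn_boolPair]
  rw [clause3Fn, andFn_apply h0 (andFn_apply (hne 0 1) (andFn_apply (hne 0 2) (hne 1 2)))]
  by_cases hl : c.length = 3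
  · obtain ⟨l0, l1, l2, rfl⟩ := List.length_eq_three.1 hl
    have hinj : ∀ a b : Literal ℕ, encodingLiteral.encode a = encodingLiteral.encode b ↔ a = b :=
      fun a b => encodingLiteral.encode_injective.eq_iff
    simp [hinj, List.nodup_cons]
    by_cases h01 : l0 = l1 <;> by_cases h02 : l0 = l2 <;> by_cases h12 : l1 = l2 <;> simp [h01, h02, h12]
  · simp [hl]

/-- **The guard** `threeLitFn w = [every clause item of w has three pairwise distinct literals]`
(`allFn` over the clause items of `⟨ε, snd w⟩`). [cite: GareyJohnson1979, LO4 (p. 259)] -/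
def threeLitFn : List Bool → List Bool := allFn clause3Fn ∘ fanoutFn (fun _ => []) sndF

/-- `threeLitFn ∈ FP`. [folklore] -/
theorem threeLitFn_mem_FP : threeLitFn ∈ FP :=
  comp_mem_FP (allFn_mem_FP clause3Fn_mem_FP oneBit_clause3Fn) (fanoutFn_mem_FP (const_mem_FP _) sndF_mem_FP)

/-- `threeLitFn` is one-bit. [folklore] -/
theorem oneBit_threeLitFn : OneBit threeLitFn := (oneBit_allFn oneBit_clause3Fn).comp _

/-- **Truth of the guard on a CNF code**: `IsThreeLiteralClauses φ`. [cite: GareyJohnson1979, LO4 (p. 259)] -/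
theorem threeLitFn_encode_eq_true_iff (φ : CNF ℕ) :
    threeLitFn (encodingCNF.encode φ) = [true] ↔ φ.IsThreeLiteralClauses := by
  rw [threeLitFn, Function.comp_apply, fanoutFn_apply, encode_cnf, sndF_boolPair, allFn_boolPair oneBit_clause3Fn,
    decNil_encList]
  simp only [List.forall_mem_map, clause3Fn_boolPair_encode, List.cons.injEq, and_true, decide_eq_true_eq]
  rfl

/-! ### Unary helpers -/

/-- `ones` splits over sums. [folklore] -/
theorem ones_add (m n : ℕ) : ones (m + n) = ones m ++ ones n := List.replicate_add ..

/-- `ones (n+1)`. [folklore] -/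
theorem ones_succ' (n : ℕ) : ones (n + 1) = true :: ones n := rfl

/-- Dropping from `ones`. [folklore] -/
theorem drop_ones (m n : ℕ) : (ones n).drop m = ones (n - m) := List.drop_replicate ..

/-- A one-bit function with a known truth value has a known value (twin: `OneInThreeMaxCut.oneBit_eq_decide`
in `MaxCutGadgetMachine.lean`, a sibling development). [folklore] -/
theorem eq_decide_of_oneBit {f : List Bool → List Bool} (hf : OneBit f) {z : List Bool} {P : Prop} [Decidable P]
    (h : f z = [true] ↔ P) : f z = [decide P] := by
  obtain ⟨b, hb⟩ := hf z
  rw [hb] at h ⊢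
  cases b
  · simp only [List.cons.injEq, Bool.false_eq_true, and_true, false_iff] at h; rw [decide_eq_false h]
  · rw [decide_eq_true (h.1 rfl)]

/-- The unary tip: `1^{2o} ++ [bit]?`. [folklore] -/
theorem ones_tip (o : ℕ) (bit : Bool) : ones o ++ ones o ++ (if bit = true then [true] else []) = ones (tip o bit) := by
  cases bit
  · simp [tip, two_mul]
  · simp [tip, two_mul, List.replicate_succ']

/-- `tipFor` through `xor`. [folklore] -/
theorem tipFor_eq (s o : ℕ) : tipFor φ s o = tip o (xor (decide (s = 0)) (pol φ o)) := by
  unfold tipFor; by_cases hs : s = 0 <;> simp [hs]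

/-! ### The yardsticks `1^M` and `1^q` -/

/-- From an extractor `gW` of the code `w`: `1^{3 |fst w|}` (`= 1^M` on CNF codes). [folklore] -/
def Mf (gW : List Bool → List Bool) : List Bool → List Bool := umulFn ∘ fanoutFn (fun _ => ones 3) (fstF ∘ gW)

/-- `Mf gW ∈ FP`. [folklore] -/
theorem Mf_mem_FP {gW : List Bool → List Bool} (hW : gW ∈ FP) : Mf gW ∈ FP :=
  comp_mem_FP umulFn_mem_FP (fanoutFn_mem_FP (const_mem_FP _) (comp_mem_FP fstF_mem_FP hW))

/-- Value of `Mf` in general. [folklore] -/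
theorem Mf_apply (gW : List Bool → List Bool) (z : List Bool) : Mf gW z = ones (3 * (fstF (gW z)).length) := by
  simp [Mf, umulFn_apply]

/-- Value of `Mf` on a CNF code. [folklore] -/
theorem Mf_apply_encode {gW : List Bool → List Bool} {z : List Bool} (hW : gW z = encodingCNF.encode φ) :
    Mf gW z = ones (M φ) := by
  rw [Mf_apply, hW, encode_cnf, fstF_boolPair, List.length_replicate]; rfl

/-! ### Cyclic offsets -/

/-- `1^{off b o}` from extractors of the code, `1ᵇ` and `1ᵒ`. [folklore] -/
def offF (gW gB gO : List Bool → List Bool) : List Bool → List Bool :=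
  modLenFn ∘ fanoutFn (Mf gW) (dropFn ∘ fanoutFn gB (appF ∘ fanoutFn gO (Mf gW)))

/-- `1^{offP b a}` from extractors of the code, `1ᵇ` and `1ᵃ`. [folklore] -/
def offPF (gW gB gA : List Bool → List Bool) : List Bool → List Bool :=
  List.cons true ∘ modLenFn ∘ fanoutFn (Mf gW) (dropFn ∘ fanoutFn (List.cons true ∘ gB) (appF ∘ fanoutFn gA (Mf gW)))

/-- `offF ∈ FP`. [folklore] -/
theorem offF_mem_FP {gW gB gO : List Bool → List Bool} (hW : gW ∈ FP) (hB : gB ∈ FP) (hO : gO ∈ FP) :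
    offF gW gB gO ∈ FP :=
  comp_mem_FP modLenFn_mem_FP (fanoutFn_mem_FP (Mf_mem_FP hW)
    (comp_mem_FP dropFn_mem_FP (fanoutFn_mem_FP hB (comp_mem_FP appF_mem_FP (fanoutFn_mem_FP hO (Mf_mem_FP hW))))))

/-- `offPF ∈ FP`. [folklore] -/
theorem offPF_mem_FP {gW gB gA : List Bool → List Bool} (hW : gW ∈ FP) (hB : gB ∈ FP) (hA : gA ∈ FP) :
    offPF gW gB gA ∈ FP :=
  comp_mem_FP (cons_mem_FP true) (comp_mem_FP modLenFn_mem_FP (fanoutFn_mem_FP (Mf_mem_FP hW)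
    (comp_mem_FP dropFn_mem_FP (fanoutFn_mem_FP (comp_mem_FP (cons_mem_FP true) hB)
      (comp_mem_FP appF_mem_FP (fanoutFn_mem_FP hA (Mf_mem_FP hW)))))))

/-- **Value of `offF`.** [folklore] -/
theorem offF_apply {gW gB gO : List Bool → List Bool} {z : List Bool} {b o : ℕ} (hW : gW z = encodingCNF.encode φ)
    (hB : gB z = ones b) (hO : gO z = ones o) : offF gW gB gO z = ones (off φ b o) := by
  simp only [offF, Function.comp_apply, fanoutFn_apply, Mf_apply_encode hW, hB, hO, appF_boolPair, dropFn_boolPair,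
    modLenFn_boolPair, List.length_drop, List.length_append, List.length_replicate, off]

/-- **Value of `offPF`.** [folklore] -/
theorem offPF_apply {gW gB gA : List Bool → List Bool} {z : List Bool} {b a : ℕ} (hW : gW z = encodingCNF.encode φ)
    (hB : gB z = ones b) (hA : gA z = ones a) : offPF gW gB gA z = ones (offP φ b a) := by
  simp only [offPF, Function.comp_apply, fanoutFn_apply, Mf_apply_encode hW, hB, hA, appF_boolPair, dropFn_boolPair,
    modLenFn_boolPair, List.length_drop, List.length_append, List.length_replicate, List.length_cons, offP,
    ones_succ', Nat.sub_sub]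

/-! ### The inner test of `IsNext`, on `⟨r', 1ᵒ⟩` with `r' = ⟨w, ⟨1ᵃ, ⟨1ᵇ, 1ᶜ⟩⟩⟩` -/

/-- The code, from `⟨r', 1ᵒ⟩`. [folklore] -/
def iW : List Bool → List Bool := nthF 0 ∘ fstF
/-- `1ᵃ`, from `⟨r', 1ᵒ⟩`. [folklore] -/
def iA : List Bool → List Bool := nthF 1 ∘ fstF
/-- `1ᵇ`, from `⟨r', 1ᵒ⟩`. [folklore] -/
def iB : List Bool → List Bool := nthF 2 ∘ fstF

/-- **The inner test**: `var o = var b → ¬ (0 < off b o < offP b a)`. [folklore] -/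
def cIn : List Bool → List Bool :=
  orFn (notFn (eqPairFn ∘ fanoutFn (varF iW sndF) (varF iW iB)))
    (notFn (andFn (ltLenF ∘ fanoutFn (fun _ => []) (offF iW iB sndF)) (ltLenF ∘ fanoutFn (offF iW iB sndF) (offPF iW iB iA))))

/-- `cIn ∈ FP`. [folklore] -/
theorem cIn_mem_FP : cIn ∈ FP := by
  have hW : iW ∈ FP := comp_mem_FP (nthF_mem_FP 0) fstF_mem_FP
  have hA : iA ∈ FP := comp_mem_FP (nthF_mem_FP 1) fstF_mem_FP
  have hB : iB ∈ FP := comp_mem_FP (nthF_mem_FP 2) fstF_mem_FP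
  have hoff : offF iW iB sndF ∈ FP := offF_mem_FP hW hB sndF_mem_FP
  exact orFn_mem_FP (notFn_mem_FP (comp_mem_FP eqPairFn_mem_FP (fanoutFn_mem_FP (varF_mem_FP hW sndF_mem_FP)
      (varF_mem_FP hW hB))))
    (notFn_mem_FP (andFn_mem_FP (comp_mem_FP ltLenF_mem_FP (fanoutFn_mem_FP (const_mem_FP _) hoff))
      (comp_mem_FP ltLenF_mem_FP (fanoutFn_mem_FP hoff (offPF_mem_FP hW hB hA)))))

/-- `cIn` is one-bit. [folklore] -/
theorem oneBit_cIn : OneBit cIn :=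
  oneBit_orFn (oneBit_notFn (oneBit_eqPairFn.comp _))
    (oneBit_notFn (oneBit_andFn (oneBit_ltLenF.comp _) (oneBit_ltLenF.comp _)))

/-- The record `⟨w, ⟨1ᵃ, ⟨1ᵇ, 1ᶜ⟩⟩⟩`. [folklore] -/
def rec4 (w : List Bool) (a b c : ℕ) : List Bool := boolPair w (boolPair (ones a) (boolPair (ones b) (ones c)))

/-- **Truth of the inner test.** [folklore] -/
theorem cIn_eq_true_iff (h3 : ∀ c ∈ φ, c.length = 3) (a b c o : ℕ) :
    cIn (boolPair (rec4 (encodingCNF.encode φ) a b c) (ones o)) = [true] ↔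
      (var φ o = var φ b → ¬ (0 < off φ b o ∧ off φ b o < offP φ b a)) := by
  have hW : iW (boolPair (rec4 (encodingCNF.encode φ) a b c) (ones o)) = encodingCNF.encode φ := by simp [iW, rec4]
  have hA : iA (boolPair (rec4 (encodingCNF.encode φ) a b c) (ones o)) = ones a := by simp [iA, rec4, nthF]
  have hB : iB (boolPair (rec4 (encodingCNF.encode φ) a b c) (ones o)) = ones b := by simp [iB, rec4, nthF]
  have hO : sndF (boolPair (rec4 (encodingCNF.encode φ) a b c) (ones o)) = ones o := sndF_boolPair _ _
  generalize hz : boolPair (rec4 (encodingCNF.encode φ) a b c) (ones o) = z at hW hA hB hO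
  have e1 : (eqPairFn ∘ fanoutFn (varF iW sndF) (varF iW iB)) z = [true] ↔ var φ o = var φ b := by
    rw [Function.comp_apply, fanoutFn_apply, varF_apply h3 hW hO, varF_apply h3 hW hB, eqPairFn_boolPair_eq_true,
      encodeNat_inj]
  have e2 : (ltLenF ∘ fanoutFn (fun _ => []) (offF iW iB sndF)) z = [true] ↔ 0 < off φ b o := by
    rw [Function.comp_apply, fanoutFn_apply, offF_apply hW hB hO, ltLenF_boolPair]; simp
  have e3 : (ltLenF ∘ fanoutFn (offF iW iB sndF) (offPF iW iB iA)) z = [true] ↔ off φ b o < offP φ b a := by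
    rw [Function.comp_apply, fanoutFn_apply, offF_apply hW hB hO, offPF_apply hW hB hA, ltLenF_boolPair]; simp
  rw [cIn, orFn_eq_true_iff (oneBit_notFn (oneBit_eqPairFn.comp _))
      (oneBit_notFn (oneBit_andFn (oneBit_ltLenF.comp _) (oneBit_ltLenF.comp _))),
    notFn_eq_true_iff (oneBit_eqPairFn.comp _),
    notFn_eq_true_iff (oneBit_andFn (oneBit_ltLenF.comp _) (oneBit_ltLenF.comp _)),
    andFn_eq_true_iff (oneBit_ltLenF.comp _) (oneBit_ltLenF.comp _), e1, e2, e3]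
  constructor
  · rintro (h | h) hv
    exacts [absurd hv h, h]
  · intro h
    by_cases hv : var φ o = var φ b
    · exact Or.inr (h hv)
    · exact Or.inl hv

/-! ### The triple test `pmF`, on `r' = ⟨w, ⟨1ᵃ, ⟨1ᵇ, 1ᶜ⟩⟩⟩` -/

/-- The yardstick of the `IsNext` loop fits: `3 |fst (fst u)| ≤ |u|`. [folklore] -/
theorem length_Mf_nthF_le (u : List Bool) : (Mf (nthF 0) u).length ≤ u.length := by
  rw [Mf_apply, List.length_replicate, nthF_zero]
  have h1 := length_fstF_sndF_le u
  have h2 := length_fstF_sndF_le (fstF u)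
  omega

/-- **`[IsNext a b]`**: same variable, and the inner test for every `o < M`. [folklore] -/
def isNextF : List Bool → List Bool :=
  andFn (eqPairFn ∘ fanoutFn (varF (nthF 0) (nthF 1)) (varF (nthF 0) (nthF 2))) (allIdxFn (Mf (nthF 0)) cIn)

/-- `isNextF ∈ FP`. [folklore] -/
theorem isNextF_mem_FP : isNextF ∈ FP :=
  andFn_mem_FP (comp_mem_FP eqPairFn_mem_FP (fanoutFn_mem_FP (varF_mem_FP (nthF_mem_FP 0) (nthF_mem_FP 1))
    (varF_mem_FP (nthF_mem_FP 0) (nthF_mem_FP 2))))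
    (allIdxFn_mem_FP (Mf_mem_FP (nthF_mem_FP 0)) cIn_mem_FP oneBit_cIn)

/-- `isNextF` is one-bit. [folklore] -/
theorem oneBit_isNextF : OneBit isNextF :=
  oneBit_andFn (oneBit_eqPairFn.comp _) (oneBit_allIdxFn oneBit_cIn length_Mf_nthF_le)

/-- **Truth of `isNextF`.** [folklore] -/
theorem isNextF_eq_true_iff (h3 : ∀ c ∈ φ, c.length = 3) (a b c : ℕ) :
    isNextF (rec4 (encodingCNF.encode φ) a b c) = [true] ↔ IsNext φ a b := by
  have hW : nthF 0 (rec4 (encodingCNF.encode φ) a b c) = encodingCNF.encode φ := by simp [rec4]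
  have hA : nthF 1 (rec4 (encodingCNF.encode φ) a b c) = ones a := by simp [rec4, nthF]
  have hB : nthF 2 (rec4 (encodingCNF.encode φ) a b c) = ones b := by simp [rec4, nthF]
  rw [isNextF, andFn_eq_true_iff (oneBit_eqPairFn.comp _) (oneBit_allIdxFn oneBit_cIn length_Mf_nthF_le),
    allIdxFn_apply oneBit_cIn (length_Mf_nthF_le _), Mf_apply_encode hW, List.length_replicate]
  simp only [Function.comp_apply, fanoutFn_apply, varF_apply h3 hW hA, varF_apply h3 hW hB, eqPairFn_boolPair,
    encodeNat_inj, cIn_eq_true_iff h3, List.cons.injEq, and_true, decide_eq_true_eq]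
  rfl

/-! ### The selector test, on `r'` -/

/-- `1^{b - M}`. [folklore] -/
def rF : List Bool → List Bool := dropFn ∘ fanoutFn (Mf (nthF 0)) (nthF 2)
/-- `⟨1^{(b-M)/3}, 1^{(b-M)%3}⟩`. [folklore] -/
def dmR : List Bool → List Bool := divModFn ∘ fanoutFn (fun _ => ones 3) rF
/-- `1^{3((b-M)/3) + p}`: occurrence `p` of the clause of selector `b`. [folklore] -/
def occF (p : ℕ) : List Bool → List Bool :=
  appF ∘ fanoutFn (umulFn ∘ fanoutFn (fun _ => ones 3) (fstF ∘ dmR)) (fun _ => ones p)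
/-- The tip bit wanted by the selector at occurrence `p`: `(s = 0) xor pol o`. [folklore] -/
def condF (p : ℕ) : List Bool → List Bool := xorFn (isNilFn ∘ sndF ∘ dmR) (polF (nthF 0) (occF p))
/-- `1^{tipFor s o}` for occurrence `p`. [folklore] -/
def tipForF (p : ℕ) : List Bool → List Bool :=
  appF ∘ fanoutFn (appF ∘ fanoutFn (occF p) (occF p)) (iteFn (condF p) (fun _ => [true]) (fun _ => []))
/-- `[c = tipFor s (3j + p)]`. [folklore] -/
def eqSel (p : ℕ) : List Bool → List Bool := eqPairFn ∘ fanoutFn (sndPow 2) (tipForF p)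
/-- **`[SelP b c]`.** [folklore] -/
def selPF : List Bool → List Bool := orFn (eqSel 0) (orFn (eqSel 1) (eqSel 2))

/-- `dmR ∈ FP`. [folklore] -/
theorem dmR_mem_FP : dmR ∈ FP :=
  comp_mem_FP divModFn_mem_FP (fanoutFn_mem_FP (const_mem_FP _)
    (comp_mem_FP dropFn_mem_FP (fanoutFn_mem_FP (Mf_mem_FP (nthF_mem_FP 0)) (nthF_mem_FP 2))))

/-- `occF p ∈ FP`. [folklore] -/
theorem occF_mem_FP (p : ℕ) : occF p ∈ FP :=
  comp_mem_FP appF_mem_FP (fanoutFn_mem_FP (comp_mem_FP umulFn_mem_FP (fanoutFn_mem_FP (const_mem_FP _)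
    (comp_mem_FP fstF_mem_FP dmR_mem_FP))) (const_mem_FP _))

/-- `eqSel p ∈ FP`. [folklore] -/
theorem eqSel_mem_FP (p : ℕ) : eqSel p ∈ FP := by
  have hc : condF p ∈ FP := xorFn_mem_FP (comp_mem_FP isNilFn_mem_FP (comp_mem_FP sndF_mem_FP dmR_mem_FP))
    (polF_mem_FP (nthF_mem_FP 0) (occF_mem_FP p))
  exact comp_mem_FP eqPairFn_mem_FP (fanoutFn_mem_FP (sndPow_mem_FP 2) (comp_mem_FP appF_mem_FP (fanoutFn_mem_FP
    (comp_mem_FP appF_mem_FP (fanoutFn_mem_FP (occF_mem_FP p) (occF_mem_FP p)))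
    (iteFn_mem_FP hc (const_mem_FP _) (const_mem_FP _)))))

/-- `selPF ∈ FP`. [folklore] -/
theorem selPF_mem_FP : selPF ∈ FP := orFn_mem_FP (eqSel_mem_FP 0) (orFn_mem_FP (eqSel_mem_FP 1) (eqSel_mem_FP 2))

/-- `condF p` is one-bit. [folklore] -/
theorem oneBit_condF (p : ℕ) : OneBit (condF p) := oneBit_xorFn (oneBit_isNilFn.comp _) (oneBit_polF _ _)

/-- `eqSel p` is one-bit. [folklore] -/
theorem oneBit_eqSel (p : ℕ) : OneBit (eqSel p) := oneBit_eqPairFn.comp _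

/-- `selPF` is one-bit. [folklore] -/
theorem oneBit_selPF : OneBit selPF := oneBit_orFn (oneBit_eqSel 0) (oneBit_orFn (oneBit_eqSel 1) (oneBit_eqSel 2))

/-- Value of `dmR`. [folklore] -/
theorem dmR_apply (a b c : ℕ) :
    dmR (rec4 (encodingCNF.encode φ) a b c) = boolPair (ones ((b - M φ) / 3)) (ones ((b - M φ) % 3)) := by
  have hW : nthF 0 (rec4 (encodingCNF.encode φ) a b c) = encodingCNF.encode φ := by simp [rec4]
  simp only [dmR, rF, Function.comp_apply, fanoutFn_apply, Mf_apply_encode hW]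
  simp [rec4, nthF]

/-- Value of `occF`. [folklore] -/
theorem occF_apply (p a b c : ℕ) : occF p (rec4 (encodingCNF.encode φ) a b c) = ones (3 * ((b - M φ) / 3) + p) := by
  simp only [occF, Function.comp_apply, fanoutFn_apply, dmR_apply, fstF_boolPair, umulFn_apply, sndF_boolPair,
    List.length_replicate, appF_boolPair, ones_add]

/-- **Truth of `eqSel p`.** [folklore] -/
theorem eqSel_eq_true_iff (h3 : ∀ c ∈ φ, c.length = 3) (p a b c : ℕ) :
    eqSel p (rec4 (encodingCNF.encode φ) a b c) = [true] ↔ c = tipFor φ ((b - M φ) % 3) (3 * ((b - M φ) / 3) + p) := by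
  have hW : nthF 0 (rec4 (encodingCNF.encode φ) a b c) = encodingCNF.encode φ := by simp [rec4]
  have hcond : condF p (rec4 (encodingCNF.encode φ) a b c) =
      [xor (decide ((b - M φ) % 3 = 0)) (pol φ (3 * ((b - M φ) / 3) + p))] := by
    rw [condF, xorFn_apply (b := decide ((b - M φ) % 3 = 0)) (b' := pol φ (3 * ((b - M φ) / 3) + p))]
    · simp only [Function.comp_apply, dmR_apply, sndF_boolPair, isNilFn]
      congr 1
      apply Bool.decide_congr
      constructor
      · intro h; simpa using congrArg List.length h
      · intro h; rw [h]; rfl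
    · exact polF_apply h3 hW (occF_apply p a b c)
  have htip : tipForF p (rec4 (encodingCNF.encode φ) a b c) = ones (tipFor φ ((b - M φ) % 3) (3 * ((b - M φ) / 3) + p)) := by
    rw [tipForF, Function.comp_apply, fanoutFn_apply, Function.comp_apply, fanoutFn_apply, occF_apply, appF_boolPair,
      appF_boolPair, iteFn_of_oneBit (oneBit_condF p), hcond, tipFor_eq,
      ← ones_tip]
    congr 1
    cases xor (decide ((b - M φ) % 3 = 0)) (pol φ (3 * ((b - M φ) / 3) + p)) <;> rfl
  rw [eqSel, Function.comp_apply, fanoutFn_apply, htip, eqPairFn_boolPair_eq_true]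
  simp [rec4]

/-- **Truth of `selPF`.** [folklore] -/
theorem selPF_eq_true_iff (h3 : ∀ c ∈ φ, c.length = 3) (a b c : ℕ) :
    selPF (rec4 (encodingCNF.encode φ) a b c) = [true] ↔ SelP φ b c := by
  rw [selPF, orFn_eq_true_iff (oneBit_eqSel 0) (oneBit_orFn (oneBit_eqSel 1) (oneBit_eqSel 2)),
    orFn_eq_true_iff (oneBit_eqSel 1) (oneBit_eqSel 2), eqSel_eq_true_iff h3, eqSel_eq_true_iff h3,
    eqSel_eq_true_iff h3, SelP, Nat.add_zero]

/-! ### The ring tests and the triple test `pmF`, on `r'` -/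

/-- `[b < M]`. [folklore] -/
def ltBM : List Bool → List Bool := ltLenF ∘ fanoutFn (nthF 2) (Mf (nthF 0))
/-- `[a < M]`. [folklore] -/
def ltAM : List Bool → List Bool := ltLenF ∘ fanoutFn (nthF 1) (Mf (nthF 0))
/-- `[a = b]`. [folklore] -/
def eqAB : List Bool → List Bool := eqPairFn ∘ fanoutFn (nthF 1) (nthF 2)
/-- `[c = 2b + 1]`. [folklore] -/
def eqCT : List Bool → List Bool := eqPairFn ∘ fanoutFn (sndPow 2) (List.cons true ∘ appF ∘ fanoutFn (nthF 2) (nthF 2))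
/-- `[c = 2b]`. [folklore] -/
def eqCF : List Bool → List Bool := eqPairFn ∘ fanoutFn (sndPow 2) (appF ∘ fanoutFn (nthF 2) (nthF 2))

/-- The ring alternative `(a = b ∧ c = 2b+1) ∨ (a < M ∧ IsNext a b ∧ c = 2b)`. [folklore] -/
def ringF : List Bool → List Bool := orFn (andFn eqAB eqCT) (andFn ltAM (andFn isNextF eqCF))

/-- **The triple test** `[PM a b c]`. [cite: GareyJohnson1979, Thm. 3.2 (proof)] -/
def pmF : List Bool → List Bool := orFn (andFn ltBM ringF) (andFn (notFn ltBM) (andFn eqAB selPF))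

/-- `ltBM` is one-bit. [folklore] -/
theorem oneBit_ltBM : OneBit ltBM := oneBit_ltLenF.comp _
/-- `ltAM` is one-bit. [folklore] -/
theorem oneBit_ltAM : OneBit ltAM := oneBit_ltLenF.comp _
/-- `eqAB` is one-bit. [folklore] -/
theorem oneBit_eqAB : OneBit eqAB := oneBit_eqPairFn.comp _
/-- `eqCT` is one-bit. [folklore] -/
theorem oneBit_eqCT : OneBit eqCT := oneBit_eqPairFn.comp _
/-- `eqCF` is one-bit. [folklore] -/
theorem oneBit_eqCF : OneBit eqCF := oneBit_eqPairFn.comp _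
/-- `ringF` is one-bit. [folklore] -/
theorem oneBit_ringF : OneBit ringF :=
  oneBit_orFn (oneBit_andFn oneBit_eqAB oneBit_eqCT) (oneBit_andFn oneBit_ltAM (oneBit_andFn oneBit_isNextF oneBit_eqCF))
/-- `pmF` is one-bit. [folklore] -/
theorem oneBit_pmF : OneBit pmF :=
  oneBit_orFn (oneBit_andFn oneBit_ltBM oneBit_ringF)
    (oneBit_andFn (oneBit_notFn oneBit_ltBM) (oneBit_andFn oneBit_eqAB oneBit_selPF))

/-- `pmF ∈ FP`. [folklore] -/
theorem pmF_mem_FP : pmF ∈ FP := by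
  have hM : Mf (nthF 0) ∈ FP := Mf_mem_FP (nthF_mem_FP 0)
  have h1 : ltBM ∈ FP := comp_mem_FP ltLenF_mem_FP (fanoutFn_mem_FP (nthF_mem_FP 2) hM)
  have h2 : ltAM ∈ FP := comp_mem_FP ltLenF_mem_FP (fanoutFn_mem_FP (nthF_mem_FP 1) hM)
  have h3 : eqAB ∈ FP := comp_mem_FP eqPairFn_mem_FP (fanoutFn_mem_FP (nthF_mem_FP 1) (nthF_mem_FP 2))
  have h2b : appF ∘ fanoutFn (nthF 2) (nthF 2) ∈ FP := comp_mem_FP appF_mem_FP (fanoutFn_mem_FP (nthF_mem_FP 2) (nthF_mem_FP 2))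
  have h4 : eqCT ∈ FP := comp_mem_FP eqPairFn_mem_FP (fanoutFn_mem_FP (sndPow_mem_FP 2) (comp_mem_FP (cons_mem_FP true) h2b))
  have h5 : eqCF ∈ FP := comp_mem_FP eqPairFn_mem_FP (fanoutFn_mem_FP (sndPow_mem_FP 2) h2b)
  have hr : ringF ∈ FP := orFn_mem_FP (andFn_mem_FP h3 h4) (andFn_mem_FP h2 (andFn_mem_FP isNextF_mem_FP h5))
  exact orFn_mem_FP (andFn_mem_FP h1 hr) (andFn_mem_FP (notFn_mem_FP h1) (andFn_mem_FP h3 selPF_mem_FP))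

/-- **Truth of the triple test.** [cite: GareyJohnson1979, Thm. 3.2 (proof)] -/
theorem pmF_eq_true_iff (h3 : ∀ c ∈ φ, c.length = 3) (a b c : ℕ) :
    pmF (rec4 (encodingCNF.encode φ) a b c) = [true] ↔ PM φ a b c := by
  have hW : nthF 0 (rec4 (encodingCNF.encode φ) a b c) = encodingCNF.encode φ := by simp [rec4]
  have hA : nthF 1 (rec4 (encodingCNF.encode φ) a b c) = ones a := by simp [rec4, nthF]
  have hB : nthF 2 (rec4 (encodingCNF.encode φ) a b c) = ones b := by simp [rec4, nthF]
  have hC : sndPow 2 (rec4 (encodingCNF.encode φ) a b c) = ones c := by simp [rec4, sndPow]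
  have e1 : ltBM (rec4 (encodingCNF.encode φ) a b c) = [true] ↔ b < M φ := by
    rw [ltBM, Function.comp_apply, fanoutFn_apply, hB, Mf_apply_encode hW, ltLenF_boolPair]; simp
  have e2 : ltAM (rec4 (encodingCNF.encode φ) a b c) = [true] ↔ a < M φ := by
    rw [ltAM, Function.comp_apply, fanoutFn_apply, hA, Mf_apply_encode hW, ltLenF_boolPair]; simp
  have e3 : eqAB (rec4 (encodingCNF.encode φ) a b c) = [true] ↔ a = b := by
    rw [eqAB, Function.comp_apply, fanoutFn_apply, hA, hB, eqPairFn_boolPair_eq_true, ones_inj']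
  have e4 : eqCT (rec4 (encodingCNF.encode φ) a b c) = [true] ↔ c = tip b true := by
    rw [eqCT, Function.comp_apply, fanoutFn_apply, hC, Function.comp_apply, Function.comp_apply, fanoutFn_apply, hB,
      appF_boolPair, ← ones_add, ← ones_succ', eqPairFn_boolPair_eq_true, ones_inj', tip]
    simp [two_mul]
  have e5 : eqCF (rec4 (encodingCNF.encode φ) a b c) = [true] ↔ c = tip b false := by
    rw [eqCF, Function.comp_apply, fanoutFn_apply, hC, Function.comp_apply, fanoutFn_apply, hB, appF_boolPair,
      ← ones_add, eqPairFn_boolPair_eq_true, ones_inj', tip]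
    simp [two_mul]
  have eR : ringF (rec4 (encodingCNF.encode φ) a b c) = [true] ↔
      (a = b ∧ c = tip b true) ∨ (a < M φ ∧ IsNext φ a b ∧ c = tip b false) := by
    rw [ringF, orFn_eq_true_iff (oneBit_andFn oneBit_eqAB oneBit_eqCT)
        (oneBit_andFn oneBit_ltAM (oneBit_andFn oneBit_isNextF oneBit_eqCF)),
      andFn_eq_true_iff oneBit_eqAB oneBit_eqCT, andFn_eq_true_iff oneBit_ltAM (oneBit_andFn oneBit_isNextF oneBit_eqCF),
      andFn_eq_true_iff oneBit_isNextF oneBit_eqCF, e2, e3, e4, e5, isNextF_eq_true_iff h3]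
  rw [pmF, orFn_eq_true_iff (oneBit_andFn oneBit_ltBM oneBit_ringF)
      (oneBit_andFn (oneBit_notFn oneBit_ltBM) (oneBit_andFn oneBit_eqAB oneBit_selPF)),
    andFn_eq_true_iff oneBit_ltBM oneBit_ringF,
    andFn_eq_true_iff (oneBit_notFn oneBit_ltBM) (oneBit_andFn oneBit_eqAB oneBit_selPF),
    notFn_eq_true_iff oneBit_ltBM, andFn_eq_true_iff oneBit_eqAB oneBit_selPF, e1, e3, eR, selPF_eq_true_iff h3, PM,
    not_lt]

/-- **Value of the triple test.** [folklore] -/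
theorem pmF_rec4 (h3 : ∀ c ∈ φ, c.length = 3) (a b c : ℕ) :
    pmF (rec4 (encodingCNF.encode φ) a b c) = [decide (P φ a b c)] :=
  eq_decide_of_oneBit oneBit_pmF ((pmF_eq_true_iff h3 a b c).trans PM_iff_P)

/-! ### The bit of the characteristic vector at a unary index, on `⟨w, 1ᵏ⟩` -/

/-- From an extractor `gW` of the code: `1^{6 |fst w|}` (`= 1^q` on CNF codes). [folklore] -/
def Qw (gW : List Bool → List Bool) : List Bool → List Bool := umulFn ∘ fanoutFn (fun _ => ones 6) (fstF ∘ gW)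

/-- `Qw gW ∈ FP`. [folklore] -/
theorem Qw_mem_FP {gW : List Bool → List Bool} (hW : gW ∈ FP) : Qw gW ∈ FP :=
  comp_mem_FP umulFn_mem_FP (fanoutFn_mem_FP (const_mem_FP _) (comp_mem_FP fstF_mem_FP hW))

/-- Value of `Qw` in general. [folklore] -/
theorem Qw_apply (gW : List Bool → List Bool) (z : List Bool) : Qw gW z = ones (6 * (fstF (gW z)).length) := by
  simp [Qw, umulFn_apply]

/-- `q = 6m`. [folklore] -/
theorem q_eq_six_mul (φ : CNF ℕ) : q φ = 6 * φ.length := by rw [q_eq, M_eq]; ring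

/-- Value of `Qw` on a CNF code. [folklore] -/
theorem Qw_apply_encode {gW : List Bool → List Bool} {z : List Bool} (hW : gW z = encodingCNF.encode φ) :
    Qw gW z = ones (q φ) := by
  rw [Qw_apply, hW, encode_cnf, fstF_boolPair, List.length_replicate, q_eq_six_mul]

/-- `⟨1^{k / q²}, 1^{k mod q²}⟩`. [folklore] -/
def dmA : List Bool → List Bool := divModFn ∘ fanoutFn (umulFn ∘ fanoutFn (Qw fstF) (Qw fstF)) sndF
/-- `⟨1^{(k mod q²) / q}, 1^{(k mod q²) mod q}⟩`. [folklore] -/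
def dmB : List Bool → List Bool := divModFn ∘ fanoutFn (Qw fstF) (sndF ∘ dmA)
/-- The record `⟨w, ⟨1ᵃ, ⟨1ᵇ, 1ᶜ⟩⟩⟩` of the triple with linear index `k`. [folklore] -/
def mkRec : List Bool → List Bool := fanoutFn fstF (fanoutFn (fstF ∘ dmA) (fanoutFn (fstF ∘ dmB) (sndF ∘ dmB)))
/-- **The bit function** of the fold: `⟨w, 1ᵏ⟩ ↦ [triple k ∈ U]`. [cite: GareyJohnson1979, Thm. 3.2 (proof)] -/
def bitFn : List Bool → List Bool := pmF ∘ mkRec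

/-- `bitFn ∈ FP`. [folklore] -/
theorem bitFn_mem_FP : bitFn ∈ FP := by
  have hQ : Qw fstF ∈ FP := Qw_mem_FP fstF_mem_FP
  have hA : dmA ∈ FP := comp_mem_FP divModFn_mem_FP (fanoutFn_mem_FP
    (comp_mem_FP umulFn_mem_FP (fanoutFn_mem_FP hQ hQ)) sndF_mem_FP)
  have hB : dmB ∈ FP := comp_mem_FP divModFn_mem_FP (fanoutFn_mem_FP hQ (comp_mem_FP sndF_mem_FP hA))
  exact comp_mem_FP pmF_mem_FP (fanoutFn_mem_FP fstF_mem_FP (fanoutFn_mem_FP (comp_mem_FP fstF_mem_FP hA)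
    (fanoutFn_mem_FP (comp_mem_FP fstF_mem_FP hB) (comp_mem_FP sndF_mem_FP hB))))

/-- `bitFn` is one-bit. [folklore] -/
theorem oneBit_bitFn : OneBit bitFn := oneBit_pmF.comp _

/-- `bitFn` has one-symbol values: linear growth with constant `1`. [folklore] -/
theorem length_bitFn_le (z : List Bool) : (bitFn z).length ≤ 1 * ((fstF z).length + 1) := by
  rw [oneBit_bitFn.length_eq]; omega

/-- Value of `mkRec` on a CNF code and a unary index. [folklore] -/
theorem mkRec_apply (φ : CNF ℕ) (k : ℕ) :
    mkRec (boolPair (encodingCNF.encode φ) (ones k)) =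
      rec4 (encodingCNF.encode φ) (k / (q φ * q φ)) (k % (q φ * q φ) / q φ) (k % (q φ * q φ) % q φ) := by
  have hQ : Qw fstF (boolPair (encodingCNF.encode φ) (ones k)) = ones (q φ) := Qw_apply_encode (fstF_boolPair _ _)
  have hA : dmA (boolPair (encodingCNF.encode φ) (ones k)) = boolPair (ones (k / (q φ * q φ))) (ones (k % (q φ * q φ))) := by
    simp only [dmA, Function.comp_apply, fanoutFn_apply, hQ, umulFn_apply, fstF_boolPair, sndF_boolPair,
      List.length_replicate, divModFn_boolPair]
  have hB : dmB (boolPair (encodingCNF.encode φ) (ones k)) =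
      boolPair (ones (k % (q φ * q φ) / q φ)) (ones (k % (q φ * q φ) % q φ)) := by
    simp only [dmB, Function.comp_apply, fanoutFn_apply, hQ, hA, sndF_boolPair, divModFn_boolPair]
  simp only [mkRec, fanoutFn_apply, Function.comp_apply, hA, hB, fstF_boolPair, sndF_boolPair, rec4]

/-- **Value of the bit function** on a code of three-literal clauses. [cite: GareyJohnson1979, Thm. 3.2 (proof)] -/
theorem bitFn_apply (h3 : ∀ c ∈ φ, c.length = 3) (k : ℕ) :
    bitFn (boolPair (encodingCNF.encode φ) (ones k)) =
      [decide (P φ (k / (q φ * q φ)) (k % (q φ * q φ) / q φ) (k % (q φ * q φ) % q φ))] := by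
  rw [bitFn, Function.comp_apply, mkRec_apply, pmF_rec4 h3]

/-! ### Tabulating the characteristic vector -/

/-- The countdown numeral `bin (Q³)`, `Q = 6 |fst w|`. [folklore] -/
def cntF : List Bool → List Bool := lenBinF ∘ umulFn ∘ fanoutFn (Qw id) (umulFn ∘ fanoutFn (Qw id) (Qw id))
/-- The initial fold record `⟨w, ⟨bin Q³, ⟨1⁰, ε⟩⟩⟩`. [folklore] -/
def initF : List Bool → List Bool := fanoutFn id (fanoutFn cntF (fun _ => boolPair [] []))
/-- **The tabulation** of the bits `k < Q³` (concatenation fold of `bitFn`). [cite: AroraBarakCC2009, §1.3 (bounded loops)] -/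
def tabF : List Bool → List Bool := sndPow 2 ∘ foldLoop appF bitFn (216 * X ^ 3) ∘ initF

/-- `tabF ∈ FP`. [cite: AroraBarakCC2009, §1.3 (bounded loops)] -/
theorem tabF_mem_FP : tabF ∈ FP := by
  have hQ : Qw id ∈ FP := Qw_mem_FP OracleCompose.id_mem_FP
  have hcnt : cntF ∈ FP := comp_mem_FP lenBinF_mem_FP (comp_mem_FP umulFn_mem_FP (fanoutFn_mem_FP hQ
    (comp_mem_FP umulFn_mem_FP (fanoutFn_mem_FP hQ hQ))))
  exact comp_mem_FP (sndPow_mem_FP 2) (comp_mem_FP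
    (foldLoop_mem_FP appF_mem_FP length_appF_le bitFn_mem_FP length_bitFn_le _)
    (fanoutFn_mem_FP OracleCompose.id_mem_FP (fanoutFn_mem_FP hcnt (const_mem_FP _))))

/-- A concatenation of single bits is a `List.ofFn`. [folklore] -/
theorem ccat_single_eq_ofFn (g : ℕ → Bool) : ∀ n : ℕ, ccat (fun j => [g j]) n = List.ofFn fun i : Fin n => g i
  | 0 => rfl
  | n + 1 => by
    rw [ccat_succ, ccat_single_eq_ofFn g n, List.ofFn_succ', List.concat_eq_append]
    rfl

/-- The code of `φ` is at least `m` symbols long. [folklore] -/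
theorem length_le_length_encode (φ : CNF ℕ) : φ.length ≤ (encodingCNF.encode φ).length := by
  rw [encode_cnf, length_boolPair, List.length_replicate]; omega

/-- **Value of the tabulation** on a code of three-literal clauses: the characteristic vector of `U`.
[cite: GareyJohnson1979, Thm. 3.2 (proof)] -/
theorem tabF_encode (h3 : ∀ c ∈ φ, c.length = 3) :
    tabF (encodingCNF.encode φ) = List.ofFn fun k : Fin (q φ * (q φ * q φ)) =>
      decide (P φ (k / (q φ * q φ)) (k % (q φ * q φ) / q φ) (k % (q φ * q φ) % q φ)) := by
  have hQ : Qw id (encodingCNF.encode φ) = ones (q φ) := Qw_apply_encode (gW := id) (z := encodingCNF.encode φ) rfl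
  have hcnt : cntF (encodingCNF.encode φ) = encodeNat (q φ * (q φ * q φ)) := by
    simp only [cntF, Function.comp_apply, fanoutFn_apply, hQ, umulFn_apply, fstF_boolPair, sndF_boolPair,
      List.length_replicate, lenBinF_apply]
  have hinit : initF (encodingCNF.encode φ) =
      boolPair (encodingCNF.encode φ) (boolPair (encodeNat (q φ * (q φ * q φ))) (boolPair (ones 0) [])) := by
    simp [initF, hcnt]
  have hk : q φ * (q φ * q φ) ≤ (216 * X ^ 3 : Polynomial ℕ).eval (encodingCNF.encode φ).length := by
    have hm := length_le_length_encode φ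
    rw [q_eq_six_mul]
    simp only [eval_mul, eval_pow, eval_X, eval_ofNat]
    calc 6 * φ.length * (6 * φ.length * (6 * φ.length)) = 216 * φ.length ^ 3 := by ring
      _ ≤ 216 * (encodingCNF.encode φ).length ^ 3 := Nat.mul_le_mul_left _ (Nat.pow_le_pow_left hm 3)
  rw [tabF, Function.comp_apply, Function.comp_apply, hinit, foldLoop_apply appF bitFn hk 0 [], foldAcc_appF]
  simp only [sndPow, Function.comp_apply, sndF_boolPair, List.nil_append, Nat.zero_add, bitFn_apply h3]
  exact ccat_single_eq_ofFn _ _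

/-! ### The reduction -/

/-- **The map on genuine arguments**: `⟨bin q, characteristic vector⟩`. [cite: GareyJohnson1979, Thm. 3.2 (proof)] -/
def goodF : List Bool → List Bool := fanoutFn (lenBinF ∘ Qw id) tabF

/-- `goodF ∈ FP`. [folklore] -/
theorem goodF_mem_FP : goodF ∈ FP :=
  fanoutFn_mem_FP (comp_mem_FP lenBinF_mem_FP (Qw_mem_FP OracleCompose.id_mem_FP)) tabF_mem_FP

/-- **On a code of three-literal clauses the map outputs the code of the instance `⟨q, U⟩`.**
[cite: GareyJohnson1979, Thm. 3.2 (proof)] -/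
theorem goodF_encode (h3 : ∀ c ∈ φ, c.length = 3) : goodF (encodingCNF.encode φ) = encodingTriples.encode (inst φ) := by
  rw [goodF, fanoutFn_apply, Function.comp_apply, Qw_apply_encode (gW := id) (z := encodingCNF.encode φ) rfl,
    lenBinF_apply, List.length_replicate, tabF_encode h3, encode_inst]

/-- **The guard**: the input is the canonical code of a clause list with three pairwise distinct literals
per clause (the instances of ONE-IN-THREE 3SAT; the `Nodup` part matters: `[[x, x, y]]` is one-in-three
satisfiable with `x` true, its instance `⟨q, U⟩` is then a YES instance, but its code is not in `ONEIN3SAT`).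
[cite: GareyJohnson1979, LO4 (p. 259)] -/
def guardF : List Bool → List Bool := andFn isCanonFn threeLitFn

/-- `guardF ∈ FP`. [folklore] -/
theorem guardF_mem_FP : guardF ∈ FP := andFn_mem_FP isCanonFn_mem_FP threeLitFn_mem_FP

/-- `guardF` is one-bit. [folklore] -/
theorem oneBit_guardF : OneBit guardF := oneBit_andFn oneBit_isCanonFn oneBit_threeLitFn

/-- **Truth of the guard.** [cite: GareyJohnson1979, LO4 (p. 259)] -/
theorem guardF_eq_true_iff (w : List Bool) :
    guardF w = [true] ↔ encodingCNF.encode (decCNF w) = w ∧ (decCNF w).IsThreeLiteralClauses := by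
  rw [guardF, andFn_eq_true_iff oneBit_isCanonFn oneBit_threeLitFn, isCanonFn_apply]
  simp only [List.cons.injEq, and_true, decide_eq_true_eq]
  refine and_congr_right fun h => ?_
  conv_lhs => rw [← h]
  exact threeLitFn_encode_eq_true_iff _

/-- The fixed NO instance `⟨1, ∅⟩` (one element per class, no triple). [folklore] -/
def badInst : Σ n, Finset (Fin n × Fin n × Fin n) := ⟨1, ∅⟩

/-- `⟨1, ∅⟩` has no perfect matching. [folklore] -/
theorem badInst_not_mem : badInst ∉ threeDMSet := by
  rintro ⟨W, hW, hc, -⟩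
  have : W = ∅ := Finset.subset_empty.1 hW
  rw [this, Finset.card_empty] at hc
  exact absurd hc (by decide)

/-- **The reduction function** `ONEIN3SAT → THREEDM`. [cite: GareyJohnson1979, Thm. 3.2] -/
def outF : List Bool → List Bool := iteFn guardF goodF (fun _ => encodingTriples.encode badInst)

/-- **`outF ∈ FP`.** [cite: AroraBarakCC2009, §1.3] -/
theorem outF_mem_FP : outF ∈ FP := iteFn_mem_FP guardF_mem_FP goodF_mem_FP (const_mem_FP _)

/-- Value of `outF` when the guard holds. [folklore] -/
theorem outF_of_guard {w : List Bool} (h : guardF w = [true]) : outF w = goodF w := by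
  rw [outF, iteFn_apply_true h]

/-- Value of `outF` when the guard fails. [folklore] -/
theorem outF_of_not_guard {w : List Bool} (h : ¬ guardF w = [true]) : outF w = encodingTriples.encode badInst := by
  rw [outF, iteFn_of_oneBit oneBit_guardF, if_neg h]

/-- Three pairwise distinct literals per clause: in particular three literals. [folklore] -/
theorem length_three_of_isThreeLiteralClauses (h : φ.IsThreeLiteralClauses) : ∀ c ∈ φ, c.length = 3 :=
  fun c hc => (h c hc).1

/-- **ONE-IN-THREE 3SAT `≤ₚ` 3-DIMENSIONAL MATCHING.** The polynomial-time map `outF` sends the code of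
a clause list `φ` with three pairwise distinct literals per clause to the code of the instance `⟨q, U⟩`
of `ThreeDMGadget.lean` (a perfect matching exists iff `φ` is one-in-three satisfiable,
`xSatisfiable_iff_mem_threeDMSet`) and every other string to the code of the NO instance `⟨1, ∅⟩`.
[cite: GareyJohnson1979, Thm. 3.2] [cite: Karp1972, §3  problem 17 (3-DIMENSIONAL MATCHING)] -/
theorem ONEIN3SAT_karpReducible_THREEDM : ONEIN3SAT ≤ₚ THREEDM := by
  refine ⟨outF, outF_mem_FP, fun x => ?_⟩
  show x ∈ ONEIN3SAT ↔ outF x ∈ THREEDM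
  refine ⟨fun hx => ?_, fun hx => ?_⟩
  · have hcode : encodingCNF.encode (decCNF x) = x := encode_decCNF_of_mem hx
    have hmem := hx
    rw [← hcode, mem_ONEIN3SAT_iff] at hmem
    have hg : guardF x = [true] := (guardF_eq_true_iff x).2 ⟨hcode, hmem.1⟩
    rw [outF_of_guard hg, ← hcode, goodF_encode (length_three_of_isThreeLiteralClauses hmem.1)]
    exact (encodingTriples.mem_toLanguage_iff _ _).2
      ((xSatisfiable_iff_mem_threeDMSet (length_three_of_isThreeLiteralClauses hmem.1)).1 hmem.2)
  · by_cases hg : guardF x = [true]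
    · obtain ⟨hcode, h3l⟩ := (guardF_eq_true_iff x).1 hg
      rw [outF_of_guard hg, ← hcode, goodF_encode (length_three_of_isThreeLiteralClauses h3l)] at hx
      have hx' := (encodingTriples.mem_toLanguage_iff threeDMSet _).1 hx
      rw [← hcode, mem_ONEIN3SAT_iff]
      exact ⟨h3l, (xSatisfiable_iff_mem_threeDMSet (length_three_of_isThreeLiteralClauses h3l)).2 hx'⟩
    · rw [outF_of_not_guard hg] at hx
      exact absurd ((encodingTriples.mem_toLanguage_iff _ _).1 hx) badInst_not_mem

/-- **3-DIMENSIONAL MATCHING is NP-hard, given the NP-hardness of ONE-IN-THREE 3SAT** (hardness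
propagates along `≤ₚ`, `IsHard.of_reducible_holds`). The unconditional statement is assembled with
`Schaefer1978_oneInThreeSAT_NPHard_holds` in `KarpProblemsProofs.lean`. [cite: GareyJohnson1979, Thm. 3.2] -/
theorem THREEDM_isNPHard_of (h : IsNPHard ONEIN3SAT) : IsNPHard THREEDM :=
  IsHard.of_reducible_holds h ONEIN3SAT_karpReducible_THREEDM

end ThreeDM

end Literature.Computability.Complexity

end
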